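import Summits.AtomisticToContinuum.FouriersLaw.Theses.CoercivePulse
import Summits.AtomisticToContinuum.FouriersLaw.Theorems.CoercivePulseAbelRegularityCurrentCorrelationBasics
import Summits.AtomisticToContinuum.FouriersLaw.Theorems.CoercivePulseAbelRegularityFilterTransfer
import Summits.AtomisticToContinuum.FouriersLaw.Theorems.CoercivePulseAbelRegularityAbelOfIntegrableNegPart
import Summits.AtomisticToContinuum.FouriersLaw.Theorems.CoercivePulseAbelRegularityMonotoneAbelOfSignedMoment

/-!
# Skeleton of crux `CoercivePulse.AbelRegularity` (stmt-AtomisticToContinuum-15384) — line `Sketch`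
# (TAME FILTERED MEMORY: integrable anticorrelation OR one eventual sign of an iterated first moment)

Crux (route `route-AtomisticToContinuum-CoercivePulse`, rank 4; shared verbatim with
`route-AtomisticToContinuum-HoelderEscapeProfile`, rank 5), concluded BY NAME below by `AbelRegularity_of`:
for `pinnedChain ω₂ lam β γ` (`ω₂, lam, β > 0`), `T > 0`, a shift- and momentum-reversal-invariant DLR state `μ`, a
`μ`-preserving a.e. shift-covariant dynamics `D` with absolutely convergent summed current correlations
`C(t) = D.currentCorrelation μ t` and `e^{-νt}C ∈ L¹(0,∞)` (`ν > 0`): the Abel means `A(ν) = ∫₀^∞ e^{-νt} C(t) dt`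
converge in `ℝ` as `ν ↓ 0` or tend to `+∞`.

## The line (crux-ideate ideator 2, cards `integrable-anticorrelation-summable-defect` and
`signed-iterated-moment-abel-monotone`, reshaped by the line lead at pick time — see `PICKED.md`)

Write `A[F](ν) = ∫₀^∞ e^{-νt}F(t)dt` and `Dichotomy(F)` for "`A[F]` has a finite limit or tends to `+∞` along `𝓝[>]0`".
For a continuous `ψ ≥ 0` and `U ≥ 0` the CAUSALLY FILTERED memory is `F^ψ(t) = ∫_{[0,U]} ψ(u) F(t+u) du` (the memory of
the time-smoothed current); `W_k[F](t) = ∫₀ᵗ (t-s)^k · s F(s) ds` is the `k`-fold integrated first moment.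

* `stub_currentCorrelationBasics` (S1, tree glue, size S–M): under the guard, `C` is continuous, `|C| ≤ C(0)`, and
  `A[C](ν) ≥ 0` for `ν > 0` (dynamics rigidity `flow_ae_eq_canonical` + `heatVarianceCalculus_proof`:
  continuity, `V ≥ 0`, `A = (ν²/2)∫e^{-νt}V`; `currentCorrelation_positiveType_of_carrier_subset_bmGood`: `|C| ≤ C(0)`).
* `stub_filterTransfer` (S2, Fubini, size M): for continuous bounded `F`, continuous `ψ ≥ 0`, `U ≥ 0`: `F^ψ` is
  continuous, `|F^ψ| ≤ M∫ψ`; `A[F] ≥ 0 ⇒ A[F^ψ]` bounded below on `(0,1]`; and if `∫ψ > 0`,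
  `Dichotomy(F^ψ) ⇒ Dichotomy(F)` (`A[F^ψ](ν) = m(ν)A[F](ν) − R(ν)`, `m(ν) = ∫ψ(u)e^{νu} → ∫ψ > 0`,
  `R(ν) = ∫ψ(u)e^{νu}∫₀ᵘe^{-νs}F → R₀`).
* `stub_abelOfIntegrableNegPart` (S3, size S–M; replaces card 2's Fekete chain): continuous bounded `F` with
  `F⁻ ∈ L¹(0,∞)` ⇒ `Dichotomy(F)` (`A = ∫e^{-νt}F⁺ − ∫e^{-νt}F⁻`, first term antitone in `ν`, second convergent).
* `stub_monotoneAbelOfSignedMoment` (S4, size M–L; card 1's first lemma, Pólya–Szegő V.80/82 integrated): continuous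
  bounded `F`, `A[F]` bounded below on `(0,1]`, `W_k[F]` of one sign on `[t₀,∞)` ⇒ `Dichotomy(F)`
  (`−A′(ν) = ∫te^{-νt}F = ν^{k+1}(k!)⁻¹∫e^{-νt}W_k` by one Fubini and `∫₀^∞u^k e^{-νu}du = k!/ν^{k+1}`, so
  `A ∓ Kν^{k+2}` is monotone on `(0,∞)`; a monotone function has a limit at `0⁺`).
* `stub_tameFilteredMemory` (S5, the load-bearing PHYSICS stub, OPEN): under the guard there is a causal filter
  `(ψ, U)` with `∫ψ > 0` such that `(C^ψ)⁻ ∈ L¹(0,∞)` OR some `W_k[C^ψ]` keeps one sign on some `[t₀, ∞)`.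

COMPOSITION (`AbelRegularity_of : stub_tameFilteredMemory → AbelRegularity`, sorry-free; S1–S4 LANDED as
`Theorems/CoercivePulseAbelRegularity{CurrentCorrelationBasics,FilterTransfer,AbelOfIntegrableNegPart,MonotoneAbelOfSignedMoment}.lean`,
p165910 / p166386 / p166105 / p166791, and discharged inside the proof): S1 gives continuity, the bound `M = C(0)` and `A[C] ≥ 0`; S5 gives the
filter and the disjunction; S2 gives the regularity of `C^ψ`, the lower bound of `A[C^ψ]` and the transfer; S3 (first
branch) or S4 (second branch) gives `Dichotomy(C^ψ)`; the transfer gives `Dichotomy(C)`, which is the crux's conclusion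
verbatim. Disproof used: none mounted (payload `disproof_path` absent in this jail, `ledger crux ls`: no Disproof.lean);
landed negatives `Theorems/AbelRegularity/Negative/PoissonMeansOscillate.lean` (p150651) honoured: S3/S4 add time-domain
structure beyond positive type (`not_poissonMeans_dichotomy`), and `A ≥ 0` enters through `PreservesMeasure`
(`abelRegularity_false_without_carrierAE`).

## Cycle c1 (lead continuation, 2026-08-17): S5 is the open content; FORMAL HINGES of the crux landed instead
Disproof v2 read (`Cruxes/AbelRegularity/Disproof.lean` §0–§4): S5's conclusion fails verbatim for the lacunary pulse
for every filter (`Negative.lacunaryPulse_not_tame`, p167304), so S5 needs a chain-specific zero-frequency input; none is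
in print (BLR2000 §7; presearch corpus + galaxy: none). No reshape, no wave (one stub, held by the lead). Landed
(`Theorems/CoercivePulseAbelRegularity*.lean`, namespace `…Theorems.AbelRegularity.Sketch`, all `--supports` helpers):
* `abelRegularity_of_uniformAbelianRegularity : CoercivePulse.UniformAbelianRegularity → CoercivePulse.AbelRegularity`
  (p172105) — the route's own (R), item stmt-AtomisticToContinuum-13416, implies the crux (common Abel limit by
  `LoomisCompactHorizonWitness.stub_regularityIffCommonLimit`, DLR uniqueness, dynamics rigidity, transport to bath
  constant 1): the crux is REDUNDANT in-route given (R), exactly as `LinearCeiling` via `SpikeLemma`;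
* `abelRegularity_iff_witness` (p172174) — the crux is one statement about the canonical pair at bath constant 1
  (Disproof §0 made importable);
* `abelRegularity_of_quasiSuperadditiveHeatVariance : CageBudgetFekete.QuasiSuperadditiveHeatVariance →
  CoercivePulse.AbelRegularity` (p172807, with the continuous Fekete lemma p172449 and the Widder/comparison Abelian
  steps p172445) — the cage-budget crux stmt-AtomisticToContinuum-15769 of the sibling route is a second existing-item
  handle (Einstein–Helfand slope `lim V_T(t)/t ∈ [0,+∞]` ⇒ Abel dichotomy).
S5 (`stub_tameFilteredMemory`) stays registered as the (R)-free, Q-free time-domain handle of this line.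
-/

noncomputable section

namespace Summit.AtomisticToContinuum.FouriersLaw.Cruxes.AbelRegularity.Sketch

open Filter Topology MeasureTheory

/-! ## Part I — registered stubs (`sorry` only here) -/

/-- **Stub S1 — `currentCorrelationBasics` (tree glue).** Under the crux guard: `t ↦ C(t)` is continuous,
`|C(t)| ≤ C(0)` for all `t`, and the Abel means are non-negative, `∫₀^∞ e^{-νt}C(t)dt ≥ 0` for `ν > 0`.
In tree: `Theorems.HeatVarianceCalculus.CanonicalRigidity.flow_ae_eq_canonical` / `heatVarianceCalculus_proof`
(continuity, `V ≥ 0`, `A = (ν²/2)∫e^{-νt}V`) and `currentCorrelation_positiveType_of_carrier_subset_bmGood` (`|C| ≤ C(0)`).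
Size S–M. [folklore] -/
theorem Holds.stub_currentCorrelationBasics :
    ∀ ω₂ lam β γ : ℝ, 0 < ω₂ → 0 < lam → 0 < β → ∀ T : ℝ, 0 < T → ∀ μ : MeasureTheory.Measure Literature.MathematicalPhysics.KineticTheory.HeatConduction.ChainConfig, (Literature.MathematicalPhysics.KineticTheory.HeatConduction.pinnedChain ω₂ lam β γ).IsChainGibbsMeasure T μ → Literature.MathematicalPhysics.KineticTheory.HeatConduction.IsShiftInvariant μ → μ.map (fun σ : Literature.MathematicalPhysics.KineticTheory.HeatConduction.ChainConfig => fun x : ℤ => ((σ x).1, -(σ x).2)) = μ → ∀ D : Literature.MathematicalPhysics.KineticTheory.HeatConduction.InfiniteChainDynamics (Literature.MathematicalPhysics.KineticTheory.HeatConduction.pinnedChain ω₂ lam β γ), D.PreservesMeasure μ → (∀ t : ℝ, ∀ᵐ σ ∂μ, D.flow t (Literature.MathematicalPhysics.KineticTheory.HeatConduction.shift σ) = Literature.MathematicalPhysics.KineticTheory.HeatConduction.shift (D.flow t σ)) → (∀ t : ℝ, D.HasAbsConvergentCorrelation μ t) → (∀ ν : ℝ, 0 < ν → MeasureTheory.IntegrableOn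 (fun t : ℝ => Real.exp (-(ν * t)) * D.currentCorrelation μ t) (Set.Ioi 0)) → Continuous (fun t : ℝ => D.currentCorrelation μ t) ∧ (∀ t : ℝ, |D.currentCorrelation μ t| ≤ D.currentCorrelation μ 0) ∧ ∀ ν : ℝ, 0 < ν → 0 ≤ ∫ t in Set.Ioi (0:ℝ), Real.exp (-(ν * t)) * D.currentCorrelation μ t :=
  _root_.Summit.AtomisticToContinuum.FouriersLaw.Theorems.AbelRegularity.Sketch.stub_currentCorrelationBasics

/-- **Stub S2 — `filterTransfer` (causal filtering of a bounded continuous memory; Fubini).** For continuous `F`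
with `|F| ≤ M`, continuous `ψ ≥ 0` and `U ≥ 0`, with `F^ψ(t) = ∫_{[0,U]} ψ(u)F(t+u)du`: (i) `F^ψ` is continuous;
(ii) `|F^ψ(t)| ≤ M∫_{[0,U]}ψ`; (iii) if `A[F](ν) ≥ 0` for all `ν > 0` then `A[F^ψ]` is bounded below on `(0,1]`;
(iv) if `∫_{[0,U]}ψ > 0` then `Dichotomy(F^ψ) ⇒ Dichotomy(F)`. Proof sketch: Fubini on `[0,U] × (0,∞)` gives
`A[F^ψ](ν) = ∫ψ(u)e^{νu}(A[F](ν) − ∫₀ᵘe^{-νs}F(s)ds)du`, i.e. `A[F^ψ] = m(ν)A[F] − R(ν)` with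
`m(ν) = ∫ψ(u)e^{νu}du → ∫ψ > 0`, `|R(ν)| ≤ e^{νU}MU∫ψ`, `R(ν) → ∫ψ(u)∫₀ᵘF` as `ν ↓ 0`. Size M. [folklore] -/
theorem Holds.stub_filterTransfer :
    ∀ (F : ℝ → ℝ) (M : ℝ) (ψ : ℝ → ℝ) (U : ℝ), Continuous F → (∀ t : ℝ, |F t| ≤ M) → Continuous ψ → 0 ≤ U → (∀ u : ℝ, 0 ≤ ψ u) → Continuous (fun t : ℝ => ∫ u in Set.Icc (0:ℝ) U, ψ u * F (t + u)) ∧ (∀ t : ℝ, |∫ u in Set.Icc (0:ℝ) U, ψ u * F (t + u)| ≤ M * ∫ u in Set.Icc (0:ℝ) U, ψ u) ∧ ((∀ ν : ℝ, 0 < ν → 0 ≤ ∫ t in Set.Ioi (0:ℝ), Real.exp (-(ν * t)) * F t) → ∃ b : ℝ, ∀ ν : ℝ, 0 < ν → ν ≤ 1 → b ≤ ∫ t in Set.Ioi (0:ℝ), Real.exp (-(ν * t)) * ∫ u in Set.Icc (0:ℝ) U, ψ u * F (t + u)) ∧ (0 < ∫ u in Set.Icc (0:ℝ) U, ψ u →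 ((∃ L : ℝ, Filter.Tendsto (fun ν : ℝ => ∫ t in Set.Ioi (0:ℝ), Real.exp (-(ν * t)) * ∫ u in Set.Icc (0:ℝ) U, ψ u * F (t + u)) (nhdsWithin (0:ℝ) (Set.Ioi 0)) (nhds L)) ∨ Filter.Tendsto (fun ν : ℝ => ∫ t in Set.Ioi (0:ℝ), Real.exp (-(ν * t)) * ∫ u in Set.Icc (0:ℝ) U, ψ u * F (t + u)) (nhdsWithin (0:ℝ) (Set.Ioi 0)) Filter.atTop) → ((∃ L : ℝ, Filter.Tendsto (fun ν : ℝ => ∫ t in Set.Ioi (0:ℝ), Real.exp (-(ν * t)) * F t) (nhdsWithin (0:ℝ) (Set.Ioi 0)) (nhds L)) ∨ Filter.Tendsto (fun ν : ℝ => ∫ t in Set.Ioi (0:ℝ), Real.exp (-(ν * t)) * F t) (nhdsWithin (0:ℝ) (Set.Ioi 0)) Filter.atTop)) :=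
  _root_.Summit.AtomisticToContinuum.FouriersLaw.Theorems.AbelRegularity.Sketch.stub_filterTransfer

/-- **Stub S3 — `abelOfIntegrableNegPart` (integrable anticorrelation gives the Abel dichotomy).** For continuous
`F` with `|F| ≤ M` and `F⁻ = max(−F, 0) ∈ L¹(0,∞)`: `A[F](ν) = ∫₀^∞e^{-νt}F` converges in `ℝ` or tends to `+∞` as
`ν ↓ 0`. Proof sketch: `A[F] = P − N` with `P(ν) = ∫e^{-νt}F⁺` ANTITONE in `ν` on `(0,∞)` (so `P →` its supremum in
`(−∞,+∞]` as `ν ↓ 0`) and `N(ν) = ∫e^{-νt}F⁻ → ∫F⁻` (dominated convergence, bound `F⁻`). Size S–M. [folklore] -/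
theorem Holds.stub_abelOfIntegrableNegPart :
    ∀ (F : ℝ → ℝ) (M : ℝ), Continuous F → (∀ t : ℝ, |F t| ≤ M) → MeasureTheory.IntegrableOn (fun t : ℝ => max (-F t) 0) (Set.Ioi 0) → (∃ L : ℝ, Filter.Tendsto (fun ν : ℝ => ∫ t in Set.Ioi (0:ℝ), Real.exp (-(ν * t)) * F t) (nhdsWithin (0:ℝ) (Set.Ioi 0)) (nhds L)) ∨ Filter.Tendsto (fun ν : ℝ => ∫ t in Set.Ioi (0:ℝ), Real.exp (-(ν * t)) * F t) (nhdsWithin (0:ℝ) (Set.Ioi 0)) Filter.atTop :=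
  _root_.Summit.AtomisticToContinuum.FouriersLaw.Theorems.AbelRegularity.Sketch.stub_abelOfIntegrableNegPart

/-- **Stub S4 — `monotoneAbelOfSignedMoment` (one eventual sign of an iterated first moment makes the Abel curve
monotone up to a polynomial; Pólya–Szegő II.V.80/82 integrated).** For continuous `F` with `|F| ≤ M`, `A[F]` bounded
below by `b` on `(0,1]`, and `W_k(t) = ∫₀ᵗ(t-s)^k·sF(s)ds` of one (weak) sign on `[t₀,∞)`: `A[F]` converges in `ℝ` or
tends to `+∞` as `ν ↓ 0`. Proof sketch: `A` is differentiable on `(0,∞)` with `−A′(ν) = Φ(ν) = ∫₀^∞te^{-νt}F(t)dt`,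
and `Φ(ν) = ν^{k+1}(k!)⁻¹∫₀^∞e^{-νt}W_k(t)dt` (Fubini: `∫_s^∞e^{-νt}(t-s)^k dt = e^{-νs}k!/ν^{k+1}`); an eventual sign
of `W_k` bounds the wrong-signed part of `Φ` by `K′ν^{k+1}`, `K′ = (k!)⁻¹t₀·sup_{[0,t₀]}|W_k|`, so `A − Kν^{k+2}` is
antitone (`W_k ≥ 0`) or `A + Kν^{k+2}` is monotone (`W_k ≤ 0`) on `(0,∞)`, `K = K′/(k+2)`; monotone functions have
one-sided limits, and the lower bound `b` excludes `−∞`. Size M–L. [cite: PolyaSzego1976, Part V Problems 80, 82] -/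
theorem Holds.stub_monotoneAbelOfSignedMoment :
    ∀ (F : ℝ → ℝ) (M b t₀ : ℝ) (k : ℕ), Continuous F → (∀ t : ℝ, |F t| ≤ M) → (∀ ν : ℝ, 0 < ν → ν ≤ 1 → b ≤ ∫ t in Set.Ioi (0:ℝ), Real.exp (-(ν * t)) * F t) → ((∀ t : ℝ, t₀ ≤ t → 0 ≤ ∫ s in (0:ℝ)..t, (t - s) ^ k * (s * F s)) ∨ (∀ t : ℝ, t₀ ≤ t → ∫ s in (0:ℝ)..t, (t - s) ^ k * (s * F s) ≤ 0)) → (∃ L : ℝ, Filter.Tendsto (fun ν : ℝ => ∫ t in Set.Ioi (0:ℝ), Real.exp (-(ν * t)) * F t) (nhdsWithin (0:ℝ) (Set.Ioi 0)) (nhds L)) ∨ Filter.Tendsto (fun ν : ℝ => ∫ t in Set.Ioi (0:ℝ), Real.exp (-(ν * t)) * F t) (nhdsWithin (0:ℝ) (Set.Ioi 0)) Filter.atTop :=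
  _root_.Summit.AtomisticToContinuum.FouriersLaw.Theorems.AbelRegularity.Sketch.stub_monotoneAbelOfSignedMoment

/-- **Stub S5 — `tameFilteredMemory` (the load-bearing PHYSICS stub; OPEN).** Under the crux guard there is a causal
filter — a continuous `ψ ≥ 0` and `U ≥ 0` with `∫_{[0,U]}ψ > 0` — such that the filtered summed-current memory
`C^ψ(t) = ∫_{[0,U]}ψ(u)C(t+u)du` (the memory of the time-smoothed total current, an `L²`-coboundary modification of
`(∫ψ)·J`) is TAME in one of two senses: its negative part is integrable on `(0,∞)` (card
`integrable-anticorrelation-summable-defect`: finite total anticorrelation of the equilibrium heat current), OR some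
iterated first moment `W_k[C^ψ](t) = ∫₀ᵗ(t-s)^k·sC^ψ(s)ds` keeps one weak sign on some `[t₀,∞)` (card
`signed-iterated-moment-abel-monotone`: persistent or caged orientation of the memory). Why plausibly true: the pinned
chain has one even conserved field, so its TOTAL current carries no one-loop hydrodynamic tail; in the kinetic corner the
memory is completely monotone (`C_kin ≥ 0`, Aoki–Lukkarinen–Spohn 2006 (3.25)), in the hot window the cage lobe has finite
area (kit j024901/j025038: `∫C⁻` saturates, each `W_k` changes sign at most once); the filter removes phonon coherence at
frequencies `≳ √ω₂` first. Why it might fail: endless alternation of persistent and anti-persistent epochs of the heat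
current on geometrically growing time scales with non-integrable anticorrelation (the crux's lacunary failure mode in
the time domain); nothing known for a deterministic anharmonic chain excludes it (BonettoLebowitzReyBellet2000 §7).
Size XL / open. -/
theorem Holds.stub_tameFilteredMemory :
    ∀ ω₂ lam β γ : ℝ, 0 < ω₂ → 0 < lam → 0 < β → ∀ T : ℝ, 0 < T → ∀ μ : MeasureTheory.Measure Literature.MathematicalPhysics.KineticTheory.HeatConduction.ChainConfig, (Literature.MathematicalPhysics.KineticTheory.HeatConduction.pinnedChain ω₂ lam β γ).IsChainGibbsMeasure T μ → Literature.MathematicalPhysics.KineticTheory.HeatConduction.IsShiftInvariant μ → μ.map (fun σ : Literature.MathematicalPhysics.KineticTheory.HeatConduction.ChainConfig => fun x : ℤ => ((σ x).1, -(σ x).2)) = μ → ∀ D : Literature.MathematicalPhysics.KineticTheory.HeatConduction.InfiniteChainDynamics (Literature.MathematicalPhysics.KineticTheory.HeatConduction.pinnedChain ω₂ lam β γ), D.PreservesMeasure μ → (∀ t : ℝ, ∀ᵐ σ ∂μ, D.flow t (Literature.MathematicalPhysics.KineticTheory.HeatConduction.shift σ) = Literature.MathematicalPhysics.KineticTheory.HeatConduction.shift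 (D.flow t σ)) → (∀ t : ℝ, D.HasAbsConvergentCorrelation μ t) → (∀ ν : ℝ, 0 < ν → MeasureTheory.IntegrableOn (fun t : ℝ => Real.exp (-(ν * t)) * D.currentCorrelation μ t) (Set.Ioi 0)) → ∃ (ψ : ℝ → ℝ) (U : ℝ), Continuous ψ ∧ 0 ≤ U ∧ (∀ u : ℝ, 0 ≤ ψ u) ∧ 0 < ∫ u in Set.Icc (0:ℝ) U, ψ u ∧ (MeasureTheory.IntegrableOn (fun t : ℝ => max (-(∫ u in Set.Icc (0:ℝ) U, ψ u * D.currentCorrelation μ (t + u))) 0) (Set.Ioi 0) ∨ ∃ (k : ℕ) (t₀ : ℝ), (∀ t : ℝ, t₀ ≤ t → 0 ≤ ∫ s in (0:ℝ)..t, (t - s) ^ k * (s * ∫ u in Set.Icc (0:ℝ) U, ψ u * D.currentCorrelation μ (s + u))) ∨ (∀ t : ℝ, t₀ ≤ t → ∫ s in (0:ℝ)..t, (t - s) ^ k * (s * ∫ u in Set.Icc (0:ℝ) U, ψ u * D.currentCorrelation μ (s + u)) ≤ 0)) := by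
  sorry

/-! ### By-name handles of the five statements (no second copy of the text) -/

/-- Statement of registered stub S1 (`Holds.stub_currentCorrelationBasics`), by name. -/
def stub_currentCorrelationBasics : Prop := type_of% Holds.stub_currentCorrelationBasics

/-- Statement of registered stub S2 (`Holds.stub_filterTransfer`), by name. -/
def stub_filterTransfer : Prop := type_of% Holds.stub_filterTransfer

/-- Statement of registered stub S3 (`Holds.stub_abelOfIntegrableNegPart`), by name. -/
def stub_abelOfIntegrableNegPart : Prop := type_of% Holds.stub_abelOfIntegrableNegPart

/-- Statement of registered stub S4 (`Holds.stub_monotoneAbelOfSignedMoment`), by name. -/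
def stub_monotoneAbelOfSignedMoment : Prop := type_of% Holds.stub_monotoneAbelOfSignedMoment

/-- Statement of registered stub S5 (`Holds.stub_tameFilteredMemory`), by name. -/
def stub_tameFilteredMemory : Prop := type_of% Holds.stub_tameFilteredMemory

/-! ## Part II — the skeleton theorem: the five stubs give the crux BY NAME (sorry-free) -/

/-- **`AbelRegularity_of`** — `stub_tameFilteredMemory → CoercivePulse.AbelRegularity` (the four analysis/glue
stubs S1–S4 are LANDED theorems and are discharged inside the proof): S1 gives continuity, the bound `M = C(0)` and
`A[C] ≥ 0`; S5 the filter `(ψ, U)` and the tameness disjunction; S2 the regularity of `C^ψ`, the lower bound of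
`A[C^ψ]` on `(0,1]` and the transfer; S3 (integrable negative part) or S4 (signed moment) the dichotomy for `C^ψ`; the
transfer returns the dichotomy for `C`, which is the crux's conclusion verbatim. [folklore] -/
theorem AbelRegularity_of (h₅ : stub_tameFilteredMemory) :
    _root_.Summit.AtomisticToContinuum.FouriersLaw.Theses.CoercivePulse.AbelRegularity := by
  have h₁ : stub_currentCorrelationBasics := Holds.stub_currentCorrelationBasics
  have h₂ : stub_filterTransfer := Holds.stub_filterTransfer
  have h₃ : stub_abelOfIntegrableNegPart := Holds.stub_abelOfIntegrableNegPart
  have h₄ : stub_monotoneAbelOfSignedMoment := Holds.stub_monotoneAbelOfSignedMoment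
  intro ω₂ lam β γ hω hl hβ T hT μ hG hSI hR D hP hSh hAC hInt
  obtain ⟨hC, hbd, hA0⟩ := h₁ ω₂ lam β γ hω hl hβ T hT μ hG hSI hR D hP hSh hAC hInt
  obtain ⟨ψ, U, hψ, hU, hψ0, hψpos, hphys⟩ := h₅ ω₂ lam β γ hω hl hβ T hT μ hG hSI hR D hP hSh hAC hInt
  obtain ⟨hGc, hGb, hGlow, htransfer⟩ :=
    h₂ (D.currentCorrelation μ) (D.currentCorrelation μ 0) ψ U hC hbd hψ hU hψ0
  refine htransfer hψpos ?_
  rcases hphys with hneg | ⟨k, t₀, hsign⟩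
  · exact h₃ (fun t : ℝ => ∫ u in Set.Icc (0:ℝ) U, ψ u * D.currentCorrelation μ (t + u)) _ hGc hGb hneg
  · obtain ⟨b, hb⟩ := hGlow hA0
    exact h₄ (fun t : ℝ => ∫ u in Set.Icc (0:ℝ) U, ψ u * D.currentCorrelation μ (t + u)) _ b t₀ k hGc hGb hb hsign

/-- D-0027 §3.3 shape: the crux from the registered stub (an `example`, so that `AbelRegularity_of` stays the unique
theorem concluding the crux; it becomes a proof once the last `sorry`, S5, is discharged). -/
example : _root_.Summit.AtomisticToContinuum.FouriersLaw.Theses.CoercivePulse.AbelRegularity :=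
  AbelRegularity_of Holds.stub_tameFilteredMemory

end Summit.AtomisticToContinuum.FouriersLaw.Cruxes.AbelRegularity.Sketch

end
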